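import Summits.BirchSwinnertonDyer.BirchSwinnertonDyer.Theorems.AdditiveBranchIMCGordTwoRankZeroIrreducible
import Literature.NumberTheory.EllipticCurves.KrausOesterle1992.TorsionCongruenceCriterion
import HarnessLib

/-!
# Crux `GordTwoRankZeroOffCaseOne` (item 19357), irreducible surjective rows: the rank-partner doors with
# the congruence binder in FINITE form (Kraus–Oesterlé 1992 Prop. 4)

Cell `bsd-addord`, seat `bsd-addord-k1-c2` (D-0074 row B1), gen 3; sequel of
`AdditiveBranchIMCGordTwoRankZeroIrreducible` (same session). HONEST FRAMING: nothing here proves the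
Birch–Swinnerton-Dyer conjecture or the crux; THEOREMS ONLY (no definition, no named fact, no `sorry`);
nothing is booked by this file.

Door 2 of the previous file and its `BSD(E,p)` twin take the congruence `E[p] ≅ E₁[p]` as the typed input
`TorsionIso W W₁ p`. Here that input is DISCHARGED from the published criterion
`KrausOesterle1992.prop4_torsionIso_of_congruences` (`hKO`: Kraus–Oesterlé, Math. Ann. 293 (1992)
Prop. 4, irreducible case, read via Fisher arXiv:2106.02033 Lemma 2.2) and its FINITE list of trace
congruences `a_ℓ(E) ≡ a_ℓ(E₁) (mod p)` (`ℓ ∤ N N₁`) resp. `a_ℓ(E)·a_ℓ(E₁) ≡ ℓ + 1` (`ℓ ∥ N N₁`) for the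
primes `ℓ < μ(M)/6`, `M = lcm(N, N₁)·∏_{ℓ ∈ S} ℓ` — decidable per-pair DATA (`E[p]` irreducible because
`ρ̄_{E,p}` is onto). With this every binder of the booking door is a named published fact
(`hK hEPW hKO hPal` + the `PrintedFacts` / `ReadingFacts` conjuncts `hDel98 hDelG hGZK hmod hmodD`),
decidable per-pair data (cell membership, `r_an = 0`, the partner's class and rank, `Σ₀`, the shift
`Σ(δ(E₁,w) − δ(E,w))`, the congruence list) or the ONE engine value `BranchUnitCoeffAt W p b`.

References: Kraus–Oesterlé, Math. Ann. 293 (1992) Prop. 4 [KrausOesterle1992]; Fisher, arXiv:2106.02033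
Lemma 2.2; Emerton–Pollack–Weston, Invent. Math. 163 (2006) Thms. 3.3.2/3.3.3 [EmertonPollackWeston2006];
Kato, Astérisque 295 (2004) Thm. 17.4 (3) [Kato2004Asterisque]; Delbourgo, Compositio Math. 113 (1998)
Prop. 4 [Delbourgo1998]; Miller, LMS J. Comput. Math. 14 (2011) Def. 1.1 [Miller2011LMS].
-/

noncomputable section

open scoped Classical MatrixGroups ModularForm NumberField

open CongruenceSubgroup WeierstrassCurve NumberField IsDedekindDomain Field
  Literature.NumberTheory.EllipticCurves
  Literature.NumberTheory.EllipticCurves.ModularForms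
  Literature.NumberTheory.EllipticCurves.Rank1Residual
  Literature.NumberTheory.EllipticCurves.Rank1Residual.Typed
  Literature.NumberTheory.EllipticCurves.GreenbergSelmer
  Literature.NumberTheory.EllipticCurves.Wuthrich2014
  Literature.NumberTheory.EllipticCurves.GreenbergVatsal2000
  Literature.NumberTheory.EllipticCurves.EmertonPollackWeston2006
  Literature.NumberTheory.GaloisRepresentations
  Summit.BirchSwinnertonDyer.Rank1Residual.X1.MuLambda
  Summit.BirchSwinnertonDyer.Rank1Residual.Iwasawa

open Summit.BirchSwinnertonDyer.Rank1Residual.X1.CongruenceTransfer (TorsionIso CongruentLambdaShift)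

set_option autoImplicit false
set_option linter.dupNamespace false

namespace Summit.BirchSwinnertonDyer.BirchSwinnertonDyer.Theorems.AdditiveBranchIMCGordTwoRankZeroIrreducible

open Summit.BirchSwinnertonDyer.Rank1Residual
open Summit.BirchSwinnertonDyer.Rank1Residual.Additive
open Summit.BirchSwinnertonDyer.Rank1Residual.AdditivePotMult
open Summit.BirchSwinnertonDyer.BirchSwinnertonDyer.Theses.AdditiveBranchIMC

variable {W : WeierstrassCurve ℚ} [W.IsElliptic] [W.IsGloballyMinimal] {p : ℕ} [hp : Fact p.Prime]

/-- **Door 2 with the Kraus–Oesterlé certificate** — cell (G-ord, `e = 2`) ∩ {`ρ̄_{E,p}` onto} ∩ `r_an = 0`,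
every odd `p`: as `missingLowerBoundAt_rankZero_surj_of_epw_of_rankPartner`, the isomorphism `E[p] ≅ E₁[p]`
being supplied by Kraus–Oesterlé 1992 Prop. 4 (`hKO`) from the trace congruences `a_ℓ(E) ≡ a_ℓ(E₁)`
(`ℓ ∤ N N₁`) resp. `a_ℓ(E) a_ℓ(E₁) ≡ ℓ + 1` (`ℓ ∥ N N₁`) for all primes `ℓ < μ(M)/6`.
[cite: KrausOesterle1992, Prop. 4 (via Fisher arXiv:2106.02033 Lemma 2.2)]
[cite: EmertonPollackWeston2006, Thm. 3.3.2, Thm. 3.3.3 (2) (arXiv:math/0404484 p. 19)]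
[cite: Kato2004Asterisque, Thm. 17.4 (3) (p. 273)] [cite: Delbourgo1998, Prop. 4 (p. 144)] [cite: Miller2011LMS, Def. 1.1] -/
theorem missingLowerBoundAt_rankZero_surj_of_epw_of_rankPartner_of_krausOesterle
    (hK : Wuthrich2014.kato_halfEigenCharIdeal_dvd_cyclotomicPrime_of_surjective)
    (hEPW : muLambdaAlg_transfer_of_torsionIso_potOrd)
    (hKO : KrausOesterle1992.prop4_torsionIso_of_congruences)
    (hDelG : Delbourgo1998.prop4_rankZero_constantCoeff_eq_unit_mul_of_potGoodOrd)
    (hPal : Pal2012.thm32_sqrt_mul_realPeriodRat_twist_eq_of_prime_one_mod_four)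
    (hGZK : rank_eq_analyticRank_of_analyticRank_le_one) (hmod : hasEntireLFunction_rat)
    (hmodD : nonempty_modularParametrizationData)
    (hc : N10.CellGordTwo W p) (hsurj : Surj W p) (hr : W.analyticRank = 0)
    {W₁ : WeierstrassCurve ℚ} [W₁.IsElliptic] [W₁.IsGloballyMinimal]
    (hX₁ : ClassX4Gord W₁ p) (he₁ : semistabilityIndex W₁ p = 2) (hsurj₁ : Surj W₁ p) {r₁ : ℕ}
    (hr₁ : r₁ ≤ W₁.mordellWeilRank)
    (hcong : ∀ (ℓ : ℕ) [Fact ℓ.Prime],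
      6 * ℓ < KrausOesterle1992.gammaZeroIndex (KrausOesterle1992.modulus W W₁) →
      (padicValNat ℓ (W.conductorNorm ℤ * W₁.conductorNorm ℤ) = 0 →
          (p : ℤ) ∣ W.frobeniusTrace ℓ - W₁.frobeniusTrace ℓ) ∧
        (padicValNat ℓ (W.conductorNorm ℤ * W₁.conductorNorm ℤ) = 1 →
          (p : ℤ) ∣ W.frobeniusTrace ℓ * W₁.frobeniusTrace ℓ - (ℓ + 1)))
    (S₀ : Finset (HeightOneSpectrum (𝓞 ℚ))) (hS₀ : ∀ w ∈ S₀, ((p : ℕ) : 𝓞 ℚ) ∉ w.asIdeal)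
    (hS : ∀ w : HeightOneSpectrum (𝓞 ℚ), w ∉ S₀ → ((p : ℕ) : 𝓞 ℚ) ∉ w.asIdeal →
      W.HasGoodReductionAt w)
    (hS₁ : ∀ w : HeightOneSpectrum (𝓞 ℚ), w ∉ S₀ → ((p : ℕ) : 𝓞 ℚ) ∉ w.asIdeal →
      W₁.HasGoodReductionAt w)
    {b : ℕ} (hb : (b : ℤ) ≤ r₁ + ∑ w ∈ S₀, ((delta W₁ p w : ℤ) - (delta W p w : ℤ)))
    (hcert : BranchUnitCoeffAt W p b) : MissingLowerBoundAt W p :=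
  missingLowerBoundAt_rankZero_surj_of_epw_of_rankPartner hK hEPW hDelG hPal hGZK hmod hmodD hc hsurj hr
    hX₁ he₁ hsurj₁ hr₁
    (hKO W W₁ p (hasIrreducibleModPGaloisRep_of_hasSurjectiveModNGaloisRep W p hsurj) hcong)
    S₀ hS₀ hS hS₁ hb hcert

/-- **`BSD(E,p)` booking door with the Kraus–Oesterlé certificate**, `p ≥ 5`: as
`bsdp_rankZero_surj_of_epw_of_rankPartner` with `E[p] ≅ E₁[p]` from Kraus–Oesterlé 1992 Prop. 4
(`hKO` + the finite congruence list). Every binder is a named published fact, decidable per-pair data, or the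
one engine value `BranchUnitCoeffAt W p b`. Books nothing by itself.
[cite: KrausOesterle1992, Prop. 4 (via Fisher arXiv:2106.02033 Lemma 2.2)]
[cite: EmertonPollackWeston2006, Thm. 3.3.2, Thm. 3.3.3 (2) (arXiv:math/0404484 p. 19)]
[cite: Kato2004Asterisque, Thm. 17.4 (3) (p. 273)] [cite: Delbourgo1998, Prop. 4 (p. 144)] [cite: Miller2011LMS, Def. 1.1] -/
theorem bsdp_rankZero_surj_of_epw_of_rankPartner_of_krausOesterle
    (hK : Wuthrich2014.kato_halfEigenCharIdeal_dvd_cyclotomicPrime_of_surjective)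
    (hEPW : muLambdaAlg_transfer_of_torsionIso_potOrd)
    (hKO : KrausOesterle1992.prop4_torsionIso_of_congruences)
    (hDel98 : Delbourgo1998.prop4_rankZero_pow_dvd_constantCoeff)
    (hDelG : Delbourgo1998.prop4_rankZero_constantCoeff_eq_unit_mul_of_potGoodOrd)
    (hPal : Pal2012.thm32_sqrt_mul_realPeriodRat_twist_eq_of_prime_one_mod_four)
    (hGZK : rank_eq_analyticRank_of_analyticRank_le_one) (hmod : hasEntireLFunction_rat)
    (hmodD : nonempty_modularParametrizationData)
    (hc : N10.CellGordTwo W p) (hsurj : Surj W p) (hp5 : 5 ≤ p) (hr : W.analyticRank = 0)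
    {W₁ : WeierstrassCurve ℚ} [W₁.IsElliptic] [W₁.IsGloballyMinimal]
    (hX₁ : ClassX4Gord W₁ p) (he₁ : semistabilityIndex W₁ p = 2) (hsurj₁ : Surj W₁ p) {r₁ : ℕ}
    (hr₁ : r₁ ≤ W₁.mordellWeilRank)
    (hcong : ∀ (ℓ : ℕ) [Fact ℓ.Prime],
      6 * ℓ < KrausOesterle1992.gammaZeroIndex (KrausOesterle1992.modulus W W₁) →
      (padicValNat ℓ (W.conductorNorm ℤ * W₁.conductorNorm ℤ) = 0 →
          (p : ℤ) ∣ W.frobeniusTrace ℓ - W₁.frobeniusTrace ℓ) ∧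
        (padicValNat ℓ (W.conductorNorm ℤ * W₁.conductorNorm ℤ) = 1 →
          (p : ℤ) ∣ W.frobeniusTrace ℓ * W₁.frobeniusTrace ℓ - (ℓ + 1)))
    (S₀ : Finset (HeightOneSpectrum (𝓞 ℚ))) (hS₀ : ∀ w ∈ S₀, ((p : ℕ) : 𝓞 ℚ) ∉ w.asIdeal)
    (hS : ∀ w : HeightOneSpectrum (𝓞 ℚ), w ∉ S₀ → ((p : ℕ) : 𝓞 ℚ) ∉ w.asIdeal →
      W.HasGoodReductionAt w)
    (hS₁ : ∀ w : HeightOneSpectrum (𝓞 ℚ), w ∉ S₀ → ((p : ℕ) : 𝓞 ℚ) ∉ w.asIdeal →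
      W₁.HasGoodReductionAt w)
    {b : ℕ} (hb : (b : ℤ) ≤ r₁ + ∑ w ∈ S₀, ((delta W₁ p w : ℤ) - (delta W p w : ℤ)))
    (hcert : BranchUnitCoeffAt W p b) : BSDp W p :=
  bsdp_rankZero_surj_of_epw_of_rankPartner hK hEPW hDel98 hDelG hPal hGZK hmod hmodD hc hsurj hp5 hr hX₁ he₁
    hsurj₁ hr₁ (hKO W W₁ p (hasIrreducibleModPGaloisRep_of_hasSurjectiveModNGaloisRep W p hsurj) hcong)
    S₀ hS₀ hS hS₁ hb hcert

end Summit.BirchSwinnertonDyer.BirchSwinnertonDyer.Theorems.AdditiveBranchIMCGordTwoRankZeroIrreducible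

end
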